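import Summits.HodgeConjecture.CorCM.Census.TwentyFourCyclicFaces

/-!
# Degree-24 atlas, type `ℤ/24` (sequel): the minimality `μ(ℤ/24) ≥ 171` (kernel census)

COR-CM (cell `pub-hodgecm2`), count-neutral kernel census by the literature seat lit-andre-3 (gen 16; claim TWENTYFOUR-ATLAS), sequel of
`Census/TwentyFourCyclicFaces.lean` (same conventions, dictionary and citations).  MINIMALITY, as in `Census/IcosicCyclicMinimality.lean`
but with the surjectivity of the parity map PROVED BY INDUCTION along the growth order of the faces instead of a decided `𝔽₂`-inverse: the
`171` block parities `ℤ^{4096} → 𝔽₂^{171}` (blocks `0, …, 170`; the starting block `B₁₆₉ = 171` is left out — the `172` parities satisfy one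
relation on the Hodge lattice) are `ℤ`-linear, translation invariant and vanish on the conjugate pairs; face `k` has an ODD number of labels
in block `blk k` (exactly one) and an odd number only in blocks reached earlier (`rows_triangular`), so the parities of the faces span
`𝔽₂^{171}` (`unit_mem_rowSpan`, induction on the step) and the parity map sends `H` ONTO `𝔽₂^{171}`; hence
**`le_card_of_generates_171`**: every finite family `S ⊂ ℤ^{4096}` with `H ≤ P + Σ_{t ∈ S} ℤ[G]·t` has `|S| ≥ 171`.  The GENERIC form of
this floor for every Galois CM type `(G, c)` — `μ ≥ β − 1 − δ`, `δ = 0` for cyclic `G` — is b09's `Census/BlockParityLaw.lean` …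
`CorCM/FaceParityFloor.lean` (`card_block_le_card_add`, `…_of_isCyclic`), in the abstract currency `CMF G c →₀ ℤ`; this file is the `ℤ/24`
instance in the census currency of this row, where the upper bound lives (`Census/TwentyFourCyclicLattice.lean`: the `171` faces generate,
so `μ(ℤ/24) = μ_faces(ℤ/24) = 171 = dim_{𝔽₂}(H/P ⊗ 𝔽₂)_G` exactly).  No named fact, no `sorry`.  HC_CM is not proved anywhere in this
cell; nothing here is a headline.

## References
* [Pohlmann1968] H. Pohlmann, Algebraic cycles on abelian varieties of complex multiplication type, Ann. of Math. 88 (1968), Thm 1.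
* [Milne1999] J. S. Milne, Lefschetz motives and the Tate conjecture, Compositio Math. 117 (1999), Prop. 2.1, p. 54.
-/

namespace Summit.HodgeConjecture.CorCM.Census.TwentyFourCyclicSpecies

open Finset

/-! ## The block parities -/

/-- The block of a translated label is the block of the label. [folklore] -/
theorem blockOf_act (g : ZMod 24) (x : Pt) : blockOf (act g x) = blockOf x := by
  rcases x with ⟨i, u⟩ | ⟨b, h⟩ <;> rfl

/-- The `171` block parities `m ↦ (Σ_{x ∈ block b} m(x) mod 2)_{b ≤ 170}` (the starting block `171` left out), a map `ℤ^{4096} → 𝔽₂^{171}`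
(kept unbundled: additivity and homogeneity are `parityFun_add`, `parityFun_smul`). [folklore] -/
def parityFun (m : Pt → ℤ) (b : Fin 171) : ZMod 2 := ∑ x : Pt, if blockOf x = b.val then ((m x : ℤ) : ZMod 2) else 0

/-- The parity map is additive. [folklore] -/
theorem parityFun_add (m m' : Pt → ℤ) : parityFun (m + m') = parityFun m + parityFun m' := by
  funext b
  rw [Pi.add_apply, parityFun, parityFun, parityFun, ← Finset.sum_add_distrib]
  refine Finset.sum_congr rfl fun x _ => ?_
  rw [Pi.add_apply, Int.cast_add]
  split_ifs <;> simp

/-- The parity map is `ℤ`-homogeneous. [folklore] -/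
theorem parityFun_smul (c : ℤ) (m : Pt → ℤ) : parityFun (c • m) = c • parityFun m := by
  funext b
  rw [Pi.smul_apply, parityFun, parityFun, Finset.smul_sum]
  refine Finset.sum_congr rfl fun x _ => ?_
  rw [Pi.smul_apply]
  split_ifs <;> simp [zsmul_eq_mul]

/-- The parity map kills `0`. [folklore] -/
theorem parityFun_zero : parityFun 0 = 0 := by
  funext b
  rw [parityFun, Pi.zero_apply]
  refine Finset.sum_eq_zero fun x _ => ?_
  rw [Pi.zero_apply, Int.cast_zero, ite_self]

/-- The parities are translation invariant. [folklore] -/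
theorem parityFun_transl (g : ZMod 24) (v : Pt → ℤ) : parityFun (transl g v) = parityFun v := by
  funext b
  rw [parityFun, parityFun,
    ← Equiv.sum_comp (actEquiv g) (fun x => if blockOf x = b.val then ((transl g v x : ℤ) : ZMod 2) else 0)]
  refine Finset.sum_congr rfl fun x _ => ?_
  show (if blockOf (act g x) = b.val then ((v (act (-g) (act g x)) : ℤ) : ZMod 2) else 0) = _
  rw [blockOf_act, ← act_add, neg_add_cancel, act_zero]

/-- The parity of a square-free monomial counts its labels block by block. [folklore] -/
theorem parityFun_ind (S : Finset Pt) (b : Fin 171) : parityFun (ind S) b = ((S.filter fun x => blockOf x = b.val).card : ZMod 2) := by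
  rw [parityFun, Finset.card_filter, Nat.cast_sum]
  have e : ∀ x : Pt, (if blockOf x = b.val then (((ind S x : ℤ)) : ZMod 2) else 0) =
      if x ∈ S then (if blockOf x = b.val then (1 : ZMod 2) else 0) else 0 := by
    intro x
    unfold ind
    split_ifs <;> simp
  simp_rw [e]
  rw [Finset.sum_ite_mem, Finset.univ_inter]
  refine Finset.sum_congr rfl fun x _ => ?_
  split_ifs <;> simp

/-- The parities vanish on every conjugate pair (a pair has `0` or `2` labels in each block). [folklore] -/
theorem parityFun_pairVec (x : Pt) : parityFun (pairVec x) = 0 := by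
  funext b
  rw [pairVec, parityFun_ind, Pi.zero_apply]
  by_cases hb : blockOf x = b.val
  · have hset : ({x, act 12 x} : Finset Pt).filter (fun y => blockOf y = b.val) = {x, act 12 x} := by
      refine Finset.filter_true_of_mem fun y hy => ?_
      rw [Finset.mem_insert, Finset.mem_singleton] at hy
      rcases hy with rfl | rfl
      · exact hb
      · rw [blockOf_act]; exact hb
    rw [hset, Finset.card_pair (conj_ne x).symm]
    decide
  · have h0 : (({x, act 12 x} : Finset Pt).filter (fun y => blockOf y = b.val)).card = 0 := by
      refine Finset.card_eq_zero.mpr (Finset.filter_eq_empty_iff.mpr ?_)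
      intro y hy hby
      rw [Finset.mem_insert, Finset.mem_singleton] at hy
      rcases hy with rfl | rfl
      · exact hb hby
      · exact hb (by rw [blockOf_act] at hby; exact hby)
    rw [h0, Nat.cast_zero]

/-- The parity row of face `k`. [folklore] -/
def rowOf (k : Fin 171) (b : Fin 171) : ZMod 2 := (((orbitRep k).filter fun x => blockOf x = b.val).card : ZMod 2)

/-- The rows are the parities of the faces. [folklore] -/
theorem parityFun_atomVec (k : Fin 171) : parityFun (atomVec k) = rowOf k := by
  funext b
  rw [atomVec, parityFun_ind, rowOf]

set_option maxRecDepth 100000 in set_option maxHeartbeats 4000000 in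
/-- **Triangularity of the parity rows along the growth order**: face `k` has an odd number of labels (one) in the block `blk k`, and an odd
number of labels only in `blk k` or in blocks reached at earlier steps; every block `≤ 170` is some `blk k`; no coordinate block has step `0`. [folklore] -/
theorem rows_triangular : (∀ k : Fin 171, ((orbitRep k).filter fun x => blockOf x = blk k).card % 2 = 1) ∧
    (∀ k b : Fin 171, ((orbitRep k).filter fun x => blockOf x = b.val).card % 2 = 1 → b.val = blk k ∨ rank.getD b.val 0 ≤ k.val) ∧
    (∀ b : Fin 171, ∃ k : Fin 171, blk k = b.val) ∧ (∀ b : Fin 171, rank.getD b.val 0 ≠ 0) := by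
  refine ⟨by decide +kernel, by decide +kernel, by decide +kernel, by decide +kernel⟩

/-- Casting a count to `𝔽₂` only sees it mod `2`. [folklore] -/
theorem cast_eq_cast_mod (c : ℕ) : (c : ZMod 2) = ((c % 2 : ℕ) : ZMod 2) := (ZMod.natCast_mod c 2).symm

/-- The span of the parity rows of the faces. [folklore] -/
def rowSpan : Submodule (ZMod 2) (Fin 171 → ZMod 2) := Submodule.span (ZMod 2) (Set.range rowOf)

/-- **The parity rows span `𝔽₂^{171}`** (induction on the step at which a block is reached). [folklore] -/
theorem unit_mem_rowSpan : ∀ n : ℕ, ∀ b : Fin 171, rank.getD b.val 0 ≤ n → (Pi.single b (1 : ZMod 2) : Fin 171 → ZMod 2) ∈ rowSpan := by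
  obtain ⟨hdiag, htri, hsurj, hne⟩ := rows_triangular
  have hrank : ∀ k : Fin 171, rank.getD (blk k) 0 = k.val + 1 := atom_census.2.2.1.2.2
  intro n
  induction n with
  | zero =>
    intro b hb
    exact absurd (Nat.le_zero.mp hb) (hne b)
  | succ n ih =>
    intro b hb
    rcases Nat.lt_or_ge (rank.getD b.val 0) (n + 1) with hlt | hge
    · exact ih b (by omega)
    · obtain ⟨k, hk⟩ := hsurj b
      have hkn : k.val = n := by have h1 := hrank k; rw [hk] at h1; omega
      have hrow : rowOf k = ∑ b' : Fin 171, rowOf k b' • (Pi.single b' (1 : ZMod 2) : Fin 171 → ZMod 2) := pi_eq_sum_univ' (rowOf k)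
      rw [← Finset.add_sum_erase _ _ (Finset.mem_univ b)] at hrow
      have hdb : rowOf k b = 1 := by
        rw [rowOf, cast_eq_cast_mod, ← hk, hdiag k, Nat.cast_one]
      rw [hdb, one_smul] at hrow
      have hrest : (∑ b' ∈ univ.erase b, rowOf k b' • (Pi.single b' (1 : ZMod 2) : Fin 171 → ZMod 2)) ∈ rowSpan := by
        refine Submodule.sum_mem _ fun b' hb' => ?_
        by_cases hz : rowOf k b' = 0
        · rw [hz, zero_smul]; exact Submodule.zero_mem _
        · refine Submodule.smul_mem _ _ (ih b' ?_)
          have hodd : ((orbitRep k).filter fun x => blockOf x = b'.val).card % 2 = 1 := by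
            rw [rowOf, cast_eq_cast_mod] at hz
            have h2 : ((orbitRep k).filter fun x => blockOf x = b'.val).card % 2 < 2 := Nat.mod_lt _ (by norm_num)
            have h0 : ((orbitRep k).filter fun x => blockOf x = b'.val).card % 2 ≠ 0 := fun e => hz (by rw [e, Nat.cast_zero])
            omega
          rcases htri k b' hodd with h1 | h2
          · exact absurd (Fin.ext (by rw [h1, hk])) (Finset.ne_of_mem_erase hb')
          · omega
      have hk_mem : rowOf k ∈ rowSpan := Submodule.subset_span ⟨k, rfl⟩
      have e : (Pi.single b (1 : ZMod 2) : Fin 171 → ZMod 2) =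
          rowOf k - ∑ b' ∈ univ.erase b, rowOf k b' • (Pi.single b' (1 : ZMod 2) : Fin 171 → ZMod 2) :=
        eq_sub_of_add_eq hrow.symm
      rw [e]
      exact Submodule.sub_mem _ hk_mem hrest

/-- The parity rows span everything. [folklore] -/
theorem rowSpan_eq_top : rowSpan = ⊤ := by
  refine Submodule.eq_top_iff'.mpr fun w => ?_
  rw [pi_eq_sum_univ' w]
  refine Submodule.sum_mem _ fun b _ => Submodule.smul_mem _ _ ?_
  have hle : ∀ b : Fin 171, rank.getD b.val 0 ≤ 171 := by decide +kernel
  exact unit_mem_rowSpan 171 b (hle b)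

/-- Hodge vectors realising the unit vectors of `𝔽₂^{171}` exist (sums of faces): the parity map sends `H` onto `𝔽₂^{171}`. [folklore] -/
theorem exists_hodge_parity_single (b : Fin 171) : ∃ v ∈ hodgeLattice, parityFun v = Pi.single b 1 := by
  have hmem : (Pi.single b (1 : ZMod 2) : Fin 171 → ZMod 2) ∈ rowSpan := by rw [rowSpan_eq_top]; exact Submodule.mem_top
  refine Submodule.span_induction (p := fun w _ => ∃ v ∈ hodgeLattice, parityFun v = w) ?_ ?_ ?_ ?_ hmem
  · rintro _ ⟨k, rfl⟩
    exact ⟨atomVec k, atoms_le (atomVec_mem k), parityFun_atomVec k⟩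
  · exact ⟨0, Submodule.zero_mem _, parityFun_zero⟩
  · rintro _ _ _ _ ⟨v, hv, rfl⟩ ⟨v', hv', rfl⟩
    exact ⟨v + v', Submodule.add_mem _ hv hv', parityFun_add v v'⟩
  · rintro a _ _ ⟨v, hv, rfl⟩
    refine ⟨(a.val : ℤ) • v, Submodule.smul_mem _ _ hv, ?_⟩
    rw [parityFun_smul]
    funext i
    rw [Pi.smul_apply, Pi.smul_apply, smul_eq_mul, zsmul_eq_mul, Int.cast_natCast, ZMod.natCast_zmod_val]

/-- **MINIMALITY (`μ(ℤ/24) ≥ 171`).**  If the Hodge lattice of the `ℤ/24`-slice is generated, together with the divisor classes, by the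
translates of a finite family `S` of integer vectors, then `|S| ≥ 171` (the parity map is additive, translation invariant, kills the pairs
and maps `H` onto `𝔽₂^{171}`).  With the upper bound of `Census/TwentyFourCyclicLattice.lean`: `μ(ℤ/24) = 171`, attained by rank-four
faces; generic floor for every `(G, c)`: b09's `Census/BlockParityLaw.lean` (`card_block_le_card_add`). [folklore] -/
theorem le_card_of_generates_171 (S : Finset (Pt → ℤ))
    (hS : hodgeLattice ≤ pairs ⊔ Submodule.span ℤ {v | ∃ g : ZMod 24, ∃ t ∈ S, v = transl g t}) : 171 ≤ S.card := by
  classical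
  let T : Finset (Fin 171 → ZMod 2) := S.image parityFun
  let U : Submodule (ZMod 2) (Fin 171 → ZMod 2) := Submodule.span (ZMod 2) (T : Set (Fin 171 → ZMod 2))
  let W : Submodule ℤ (Pt → ℤ) :=
    { carrier := {v | parityFun v ∈ U}
      zero_mem' := by
        show parityFun 0 ∈ U
        rw [parityFun_zero]
        exact U.zero_mem
      add_mem' := by
        intro v w hv hw
        show parityFun (v + w) ∈ U
        rw [parityFun_add]
        exact U.add_mem hv hw
      smul_mem' := by
        intro c v hv
        show parityFun (c • v) ∈ U
        rw [parityFun_smul]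
        exact zsmul_mem hv c }
  have hle : pairs ⊔ Submodule.span ℤ {v | ∃ g : ZMod 24, ∃ t ∈ S, v = transl g t} ≤ W := by
    refine sup_le (Submodule.span_le.mpr ?_) (Submodule.span_le.mpr ?_)
    · rintro _ ⟨x, rfl⟩
      show parityFun (pairVec x) ∈ U
      rw [parityFun_pairVec x]
      exact U.zero_mem
    · rintro _ ⟨g, t, ht, rfl⟩
      show parityFun (transl g t) ∈ U
      rw [parityFun_transl]
      exact Submodule.subset_span (by simpa [T] using Finset.mem_image_of_mem parityFun ht)
  have hunit : ∀ b : Fin 171, (Pi.single b 1 : Fin 171 → ZMod 2) ∈ U := by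
    intro b
    obtain ⟨v, hv, hpv⟩ := exists_hodge_parity_single b
    have h : parityFun v ∈ U := hle (hS hv)
    rwa [hpv] at h
  have htop : U = ⊤ := by
    refine Submodule.eq_top_iff'.mpr fun w => ?_
    rw [pi_eq_sum_univ' w]
    exact Submodule.sum_mem _ fun b _ => Submodule.smul_mem _ _ (hunit b)
  have h1 : Module.finrank (ZMod 2) U ≤ T.card := finrank_span_finset_le_card T
  rw [htop, finrank_top, Module.finrank_fin_fun] at h1
  exact h1.trans Finset.card_image_le

end Summit.HodgeConjecture.CorCM.Census.TwentyFourCyclicSpecies
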